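import Mathlib
import HarnessLib

/-!
# A Lipschitz perturbation of a dilation pushes ball-uniform Lebesgue measure forward onto a multiple of ball-uniform Lebesgue measure

HONEST FRAMING: exact (Metropolis-corrected) sampling algorithms for lattice gauge theory;
figures of merit are autocorrelation/cost numbers at stated couplings and volumes; no
continuum-physics claim.

Venture `LatticeQCDFlow` (cell pub-lqcd), topic `Exactness`, FANOUT row 14 (`eng-flowhmc`, engine
`latflow.fthmc`, family B).  NEW WORK of the cell over Mathlib; nothing here is cited as a fact; no
number.  This is the abstract measure-theoretic half of the Doeblin certificate for MULTI-STEP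
(`nstep ≥ 2`) leapfrog trajectories on the `U(1)` rung (`U1LeapfrogTrajectory.lean`,
`U1MultiStepLeapfrogHMCErgodic.lean`): there the configuration proposed by `n` leapfrog steps from
`(u, p)` is `e^{iε Ψ_u(p)} · u` with `Ψ_u(p) = n • p + G_u(p)`, `G_u` BOUNDED (bounded force) and
LIPSCHITZ-SMALL (`Lip G_u < n`, a short-trajectory / no-resonance condition), and what the Doeblin
argument of row 9's `LeapfrogHMCDoeblin.refreshUpdate_involMH_minorised` consumes is a lower bound
`vol|_{ball} ≤ C • (vol|_{ball'}) ∘ Ψ_u⁻¹`.  On the momentum space `ι → ℝ` (sup norm, `ι` finite):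

* `volume_image_le_of_lipschitzOnWith` — a map `K`-Lipschitz on `s` has `vol (f '' s) ≤ K^{|ι|} vol s`
  (Mathlib: `μH[|ι|] = vol` on `ι → ℝ`, `LipschitzOnWith.hausdorffMeasure_image_le`); no
  injectivity and no derivative is needed — this is the only 'change of variables' used;
* `restrict_ball_le_smul_map_of_lipschitzOnWith` — if `Ψ` is measurable, `K`-Lipschitz on the ball
  `‖p‖ < R`, and every `y` with `‖y‖ < R'` has a `Ψ`-preimage in that ball, then
  `vol|_{‖y‖<R'} ≤ K^{|ι|} • (vol|_{‖p‖<R}) ∘ Ψ⁻¹`;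
* `exists_eq_smul_add_of_lipschitzWith` — `Ψ = a • id + G`, `G` `λ`-Lipschitz with `λ < a`,
  `‖G‖ ≤ B`: every `y` is `Ψ p` for a `p` with `‖p‖ ≤ (‖y‖ + B)/a` (Banach's fixed point for the
  contraction `q ↦ a⁻¹ • (y − G q)` of the complete space `ι → ℝ`);
* `lipschitzWith_smul_add` — such a `Ψ` is `(a + λ)`-Lipschitz;
* **`restrict_ball_le_smul_map_smul_add`** — hence
  `vol|_{‖y‖<R'} ≤ (a + λ)^{|ι|} • (vol|_{‖p‖<R}) ∘ Ψ⁻¹` whenever `(R' + B)/a ≤ R`.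

NOT here: anything about groups, kernels or integrators; the non-injective degree-theoretic version
(bounded `G` of ANY Lipschitz constant still gives surjectivity by Brouwer's theorem, which Mathlib
does not have in this generality) — the Lipschitz-small hypothesis is where the short-trajectory
condition of the multi-step theorem comes from.
-/

noncomputable section

namespace Summit.Ventures.LatticeQCDFlow.Exactness

open MeasureTheory Measure Set Metric
open scoped ENNReal NNReal

variable {ι : Type*} [Fintype ι]

/-! ## §1 Lebesgue measure of a Lipschitz image -/

/-- **A `K`-Lipschitz map of `ι → ℝ` (sup norm) inflates Lebesgue measure by at most `K^{|ι|}`**: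
`vol (f '' s) ≤ K^{|ι|} · vol s` for `f` `K`-Lipschitz on `s` (Hausdorff measure `μH[|ι|]` is
Lebesgue measure on `ι → ℝ`). -/
theorem volume_image_le_of_lipschitzOnWith {K : ℝ≥0} {f : (ι → ℝ) → ι → ℝ} {s : Set (ι → ℝ)}
    (hf : LipschitzOnWith K f s) :
    volume (f '' s) ≤ (K : ℝ≥0∞) ^ Fintype.card ι * volume s := by
  have h := hf.hausdorffMeasure_image_le (d := (Fintype.card ι : ℝ)) (Nat.cast_nonneg _)
  rwa [hausdorffMeasure_pi_real, ENNReal.rpow_natCast] at h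

/-- **Ball-uniform Lebesgue measure is dominated by the push-forward of ball-uniform Lebesgue
measure under a Lipschitz map that covers the ball.**  If `Ψ` is measurable, `K`-Lipschitz on
`‖p‖ < R`, and every `y` with `‖y‖ < R'` equals `Ψ p` for some `‖p‖ < R`, then
`vol|_{‖y‖<R'} ≤ K^{|ι|} • (vol|_{‖p‖<R}) ∘ Ψ⁻¹`. -/
theorem restrict_ball_le_smul_map_of_lipschitzOnWith {K : ℝ≥0} {Ψ : (ι → ℝ) → ι → ℝ}
    (hΨm : Measurable Ψ) {R R' : ℝ} (hK : LipschitzOnWith K Ψ (ball 0 R))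
    (hsurj : ∀ y ∈ ball (0 : ι → ℝ) R', ∃ p ∈ ball (0 : ι → ℝ) R, Ψ p = y) :
    volume.restrict (ball (0 : ι → ℝ) R') ≤
      ((K : ℝ≥0∞) ^ Fintype.card ι) • (volume.restrict (ball (0 : ι → ℝ) R)).map Ψ := by
  refine Measure.le_iff.2 fun A hA => ?_
  rw [Measure.restrict_apply hA, Measure.smul_apply, smul_eq_mul, Measure.map_apply hΨm hA,
    Measure.restrict_apply (hΨm hA)]
  have hsub : A ∩ ball 0 R' ⊆ Ψ '' (Ψ ⁻¹' A ∩ ball 0 R) := by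
    rintro y ⟨hyA, hyR⟩
    obtain ⟨p, hp, rfl⟩ := hsurj y hyR
    exact ⟨p, ⟨hyA, hp⟩, rfl⟩
  calc volume (A ∩ ball 0 R') ≤ volume (Ψ '' (Ψ ⁻¹' A ∩ ball 0 R)) := measure_mono hsub
    _ ≤ (K : ℝ≥0∞) ^ Fintype.card ι * volume (Ψ ⁻¹' A ∩ ball 0 R) :=
        volume_image_le_of_lipschitzOnWith (hK.mono inter_subset_right)

/-! ## §2 A Lipschitz-small bounded perturbation of a dilation -/

/-- **Surjectivity with a preimage bound** for `Ψ = a • id + G`, `a > 0`, `G` `λ`-Lipschitz with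
`λ < a` and `‖G‖ ≤ B`: every `y` is `Ψ p` for some `p` with `‖p‖ ≤ (‖y‖ + B)/a` — the fixed point
of the contraction `q ↦ a⁻¹ • (y − G q)`. -/
theorem exists_eq_smul_add_of_lipschitzWith {a : ℝ} (ha : 0 < a) {G : (ι → ℝ) → ι → ℝ}
    {lam : ℝ≥0} (hG : LipschitzWith lam G) (hlam : (lam : ℝ) < a) {B : ℝ} (hB : ∀ p, ‖G p‖ ≤ B)
    (y : ι → ℝ) : ∃ p : ι → ℝ, a • p + G p = y ∧ ‖p‖ ≤ (‖y‖ + B) / a := by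
  set T : (ι → ℝ) → ι → ℝ := fun q => a⁻¹ • (y - G q) with hT
  have hq0 : 0 ≤ (lam : ℝ) / a := div_nonneg (NNReal.coe_nonneg lam) ha.le
  have hTlip : LipschitzWith (Real.toNNReal ((lam : ℝ) / a)) T := by
    refine LipschitzWith.of_dist_le_mul fun q q' => ?_
    rw [Real.coe_toNNReal _ hq0, dist_eq_norm, hT]
    dsimp only
    rw [← smul_sub, sub_sub_sub_cancel_left, norm_smul, Real.norm_eq_abs, abs_of_pos (inv_pos.2 ha),
      ← dist_eq_norm, dist_comm, div_mul_eq_mul_div, le_div_iff₀ ha, mul_comm _ a, ← mul_assoc,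
      mul_inv_cancel₀ ha.ne', one_mul]
    exact hG.dist_le_mul q q'
  have hTc : ContractingWith (Real.toNNReal ((lam : ℝ) / a)) T := by
    refine ⟨?_, hTlip⟩
    rw [← NNReal.coe_lt_coe, Real.coe_toNNReal _ hq0, NNReal.coe_one, div_lt_one ha]
    exact hlam
  refine ⟨ContractingWith.fixedPoint T hTc, ?_, ?_⟩
  · have hfix : T (ContractingWith.fixedPoint T hTc) = ContractingWith.fixedPoint T hTc :=
      ContractingWith.fixedPoint_isFixedPt (hf := hTc)
    set p := ContractingWith.fixedPoint T hTc
    have h2 : a • T p = y - G p := by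
      rw [hT]
      dsimp only
      rw [smul_smul, mul_inv_cancel₀ ha.ne', one_smul]
    rw [hfix] at h2
    rw [h2, sub_add_cancel]
  · have hfix : T (ContractingWith.fixedPoint T hTc) = ContractingWith.fixedPoint T hTc :=
      ContractingWith.fixedPoint_isFixedPt (hf := hTc)
    set p := ContractingWith.fixedPoint T hTc
    rw [← hfix, hT]
    dsimp only
    rw [norm_smul, Real.norm_eq_abs, abs_of_pos (inv_pos.2 ha), le_div_iff₀ ha, mul_comm,
      ← mul_assoc, mul_inv_cancel₀ ha.ne', one_mul]
    exact (norm_sub_le _ _).trans (add_le_add le_rfl (hB p))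

/-- The dilation `p ↦ a • p` (`a ≥ 0`) is `a`-Lipschitz. -/
theorem lipschitzWith_const_smul_pi {a : ℝ} (ha : 0 ≤ a) :
    LipschitzWith (Real.toNNReal a) fun p : ι → ℝ => a • p :=
  LipschitzWith.of_dist_le_mul fun p q => by
    rw [Real.coe_toNNReal a ha, dist_eq_norm, ← smul_sub, norm_smul, Real.norm_eq_abs,
      abs_of_nonneg ha, ← dist_eq_norm]

/-- `Ψ = a • id + G` is `(a + λ)`-Lipschitz. -/
theorem lipschitzWith_smul_add {a : ℝ} (ha : 0 ≤ a) {G : (ι → ℝ) → ι → ℝ} {lam : ℝ≥0}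
    (hG : LipschitzWith lam G) :
    LipschitzWith (Real.toNNReal a + lam) fun p : ι → ℝ => a • p + G p :=
  (lipschitzWith_const_smul_pi ha).add hG

/-- `Ψ = a • id + G` is continuous. -/
theorem continuous_smul_add {a : ℝ} {G : (ι → ℝ) → ι → ℝ} {lam : ℝ≥0} (hG : LipschitzWith lam G) :
    Continuous fun p : ι → ℝ => a • p + G p :=
  (continuous_const_smul a).add hG.continuous

/-- The coercion bookkeeping `↑(a.toNNReal + λ) = ENNReal.ofReal (a + λ)` for `a ≥ 0`. -/
theorem coe_toNNReal_add_eq_ofReal {a : ℝ} (ha : 0 ≤ a) (lam : ℝ≥0) :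
    ((Real.toNNReal a + lam : ℝ≥0) : ℝ≥0∞) = ENNReal.ofReal (a + lam) := by
  rw [ENNReal.ofReal, Real.toNNReal_add ha (NNReal.coe_nonneg lam), Real.toNNReal_coe]

/-- **MAIN LEMMA.**  `Ψ = a • id + G` on `ι → ℝ` with `a > 0`, `G` `λ`-Lipschitz, `λ < a`,
`‖G‖ ≤ B`, and radii with `(R' + B)/a ≤ R`: ball-uniform Lebesgue measure of radius `R'` is
dominated by `(a + λ)^{|ι|}` times the push-forward under `Ψ` of ball-uniform Lebesgue measure of
radius `R` — `vol|_{‖y‖<R'} ≤ (a + λ)^{|ι|} • (vol|_{‖p‖<R}) ∘ Ψ⁻¹`. -/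
theorem restrict_ball_le_smul_map_smul_add {a : ℝ} (ha : 0 < a) {G : (ι → ℝ) → ι → ℝ}
    {lam : ℝ≥0} (hG : LipschitzWith lam G) (hlam : (lam : ℝ) < a) {B : ℝ} (hB : ∀ p, ‖G p‖ ≤ B)
    {R R' : ℝ} (hR : (R' + B) / a ≤ R) :
    volume.restrict (ball (0 : ι → ℝ) R') ≤
      (ENNReal.ofReal (a + lam) ^ Fintype.card ι) •
        (volume.restrict (ball (0 : ι → ℝ) R)).map fun p => a • p + G p := by
  rw [← coe_toNNReal_add_eq_ofReal ha.le lam]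
  refine restrict_ball_le_smul_map_of_lipschitzOnWith (continuous_smul_add hG).measurable
    ((lipschitzWith_smul_add ha.le hG).lipschitzOnWith) fun y hy => ?_
  obtain ⟨p, hp, hpn⟩ := exists_eq_smul_add_of_lipschitzWith ha hG hlam hB y
  refine ⟨p, mem_ball_zero_iff.2 (hpn.trans_lt (lt_of_lt_of_le ?_ hR)), hp⟩
  exact div_lt_div_of_pos_right (by linarith [mem_ball_zero_iff.1 hy]) ha

end Summit.Ventures.LatticeQCDFlow.Exactness
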